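import Literature.Claims.NS.Moschandreou2024
import HarnessLib

/-!
# Solo salvage for claim C05c `Moschandreou2024` (cell `ns-claims`, D-0090): the principal real
# Lambert-W branch EXISTS (and is unique, with branch value `W(−1/e) = −1`), and Step 3 holds

Claim skeleton: `Literature/Claims/NS/Moschandreou2024.lean` (typist-5 g2, p478433). Steps 3–6 of the
skeleton quantify over EVERY function `W : ℝ → ℝ` with `IsPrincipalLambert W`
(«e^{−W(ξ)} = W(ξ)/ξ» read on the principal real branch: `W x ≥ −1` and `W x · e^{W x} = x` for
`x ≥ −1/e`; Mathlib has no Lambert function). Without an EXISTENCE theorem those steps could hold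
vacuously; the skeleton's own internal-inconsistency record `not_step_6_of_step_5` takes
`(hex : ∃ W, IsPrincipalLambert W)` as a hypothesis, and the typist's kill kit (00:46:20Z) notes
«Not in the kit: Step_6 (needs ∃ principal W …)».

This file (salvage seat ns-claims-salvage-p5 g2; all TRUE classical facts about `w ↦ w e^w`):

* `strictMonoOn_mulExp` — `y ↦ y e^y` is strictly increasing on `[−1, ∞)`;
* `exists_isPrincipalLambert` — a principal real branch exists (intermediate value theorem on
  `[−1, max x 0]` + choice; values below `−1/e` are irrelevant and set to `0`; no `def` is
  introduced — the steps quantify over all such `W`, and `lambert_unique` says they agree);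
* `lambert_eq_of_mulExp_eq` / `lambert_apply_mulExp` — `W` inverts `y ↦ y e^y` on `[−1,∞)`;
  `lambert_unique` — any two principal branches agree on `[−1/e, ∞)`;
* `lambert_apply_branchPoint` — `W(−1/e) = −1` (the point «(−1/e, −1) where the W
  function has a first derivative singularity», §12 p.718);
* `lambert_monotoneOn`, `lambert_continuousOn` — `W` is monotone and continuous on `[−1/e, ∞)`;
* `lambert_not_differentiableWithinAt_branchPoint` — `W` is not differentiable (within
  its domain) at `−1/e` (chain rule: `1 = (1 + W)e^W · W' = 0` there);
* `step_3_holds : Step_3` — Step 3 of the skeleton (§12 p.718 L299) is TRUE, kernel-checked;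
* `not_iterDefined_two_two` — with `W(−1/e) = −1 < −1/e`, the 2-fold model iterate is NOT
  real-defined at `t = 2` (the refuter's door to `Step_6`; the kill itself is the refuter's lane).

WHAT THIS IS NOT: not a claim about NS regularity or blow-up; not a claim about any author beyond the
typed locator.
-/

-- lint debt (one line): the Theorems namespace repeats the summit name by the D-0017 layout.
set_option linter.dupNamespace false

noncomputable section

open Set Filter
open scoped Topology

namespace Summit.NavierStokesRegularity.NavierStokesRegularity.Theorems.Moschandreou2024

open Literature.Claims.NS.Moschandreou2024

/-! ### The map `y ↦ y e^y` on `[−1, ∞)` -/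

/-- `g(y) = y e^y` is continuous. [folklore] -/
theorem continuous_mulExp : Continuous (fun y : ℝ => y * Real.exp y) :=
  continuous_id.mul Real.continuous_exp

/-- `g'(y) = (1 + y) e^y`. [folklore] -/
theorem hasDerivAt_mulExp (y : ℝ) :
    HasDerivAt (fun y : ℝ => y * Real.exp y) ((1 + y) * Real.exp y) y := by
  have h := (hasDerivAt_id y).mul (Real.hasDerivAt_exp y)
  refine h.congr_deriv ?_
  simp only [id]; ring

/-- `g(−1) = −1/e`. [folklore] -/
theorem mulExp_neg_one : (-1 : ℝ) * Real.exp (-1) = -Real.exp (-1) := by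
  simp

/-- **`y ↦ y e^y` is strictly increasing on `[−1, ∞)`** (`g' = (1+y)e^y > 0` on `(−1,∞)`).
[cite: Moschandreou2024b, §4 after (5) p.702 (L137)] -/
theorem strictMonoOn_mulExp : StrictMonoOn (fun y : ℝ => y * Real.exp y) (Ici (-1)) := by
  refine strictMonoOn_of_deriv_pos (convex_Ici _) continuous_mulExp.continuousOn ?_
  intro y hy
  rw [interior_Ici] at hy
  rw [(hasDerivAt_mulExp y).deriv]
  have : 0 < 1 + y := by linarith [mem_Ioi.1 hy]
  positivity

/-- `g(y) ≥ −1/e` for `y ≥ −1`. [folklore] -/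
theorem neg_exp_neg_one_le_mulExp {y : ℝ} (hy : -1 ≤ y) : -Real.exp (-1) ≤ y * Real.exp y := by
  rw [← mulExp_neg_one]
  exact strictMonoOn_mulExp.monotoneOn (self_mem_Ici) hy hy

/-- For `x ≥ −1/e` there is `y ∈ [−1, max x 0]` with `y e^y = x` (intermediate value theorem:
`g(−1) = −1/e ≤ x ≤ max x 0 ≤ g(max x 0)`). [folklore] -/
theorem exists_mulExp_eq {x : ℝ} (hx : -Real.exp (-1) ≤ x) :
    ∃ y : ℝ, -1 ≤ y ∧ y * Real.exp y = x := by
  set b : ℝ := max x 0 with hb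
  have hb0 : 0 ≤ b := le_max_right _ _
  have hab : (-1 : ℝ) ≤ b := by linarith
  have hgb : x ≤ b * Real.exp b := by
    have h1 : x ≤ b := le_max_left _ _
    have h2 : b ≤ b * Real.exp b := by
      have : 1 ≤ Real.exp b := Real.one_le_exp hb0
      nlinarith
    linarith
  have hmem : x ∈ Icc ((-1 : ℝ) * Real.exp (-1)) (b * Real.exp b) := ⟨by rwa [mulExp_neg_one], hgb⟩
  obtain ⟨y, hy, hyx⟩ :=
    intermediate_value_Icc (f := fun y : ℝ => y * Real.exp y) hab continuous_mulExp.continuousOn hmem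
  exact ⟨y, hy.1, hyx⟩

/-! ### Existence and uniqueness of the principal branch -/

/-- **A principal real Lambert branch EXISTS** — discharging the hypothesis `hex` of the skeleton's
`not_step_6_of_step_5` and making the `∀ W, IsPrincipalLambert W → …` steps non-vacuous.
[cite: Moschandreou2024b, §4 after (5) p.702 (L137); §12 after (38) p.720 (L318)] -/
theorem exists_isPrincipalLambert : ∃ W : ℝ → ℝ, IsPrincipalLambert W := by
  refine ⟨fun x => if h : -Real.exp (-1) ≤ x then Classical.choose (exists_mulExp_eq h) else 0, ?_⟩
  intro x hx
  have hspec := Classical.choose_spec (exists_mulExp_eq hx)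
  simp only [dif_pos hx]
  exact ⟨hspec.1, hspec.2⟩

/-- `W x e^{W x} = x` in the `mulExp` spelling. [folklore] -/
theorem mulExp_lambert {W : ℝ → ℝ} (hW : IsPrincipalLambert W) {x : ℝ}
    (hx : -Real.exp (-1) ≤ x) : W x * Real.exp (W x) = x :=
  (hW x hx).2

/-- **`W` inverts `y ↦ y e^y` on `[−1, ∞)`**: if `y ≥ −1` and `y e^y = x` then `W x = y`.
[folklore] -/
theorem lambert_eq_of_mulExp_eq {W : ℝ → ℝ} (hW : IsPrincipalLambert W) {x y : ℝ}
    (hy : -1 ≤ y) (hyx : y * Real.exp y = x) : W x = y := by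
  have hx : -Real.exp (-1) ≤ x := hyx ▸ neg_exp_neg_one_le_mulExp hy
  exact strictMonoOn_mulExp.injOn (hW x hx).1 hy ((hW x hx).2.trans hyx.symm)

/-- `W (y e^y) = y` for `y ≥ −1`. [folklore] -/
theorem lambert_apply_mulExp {W : ℝ → ℝ} (hW : IsPrincipalLambert W) {y : ℝ}
    (hy : -1 ≤ y) : W (y * Real.exp y) = y :=
  lambert_eq_of_mulExp_eq hW hy rfl

/-- **Uniqueness**: two principal branches agree on `[−1/e, ∞)`. [folklore] -/
theorem lambert_unique {W W' : ℝ → ℝ} (hW : IsPrincipalLambert W)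
    (hW' : IsPrincipalLambert W') {x : ℝ} (hx : -Real.exp (-1) ≤ x) : W x = W' x :=
  lambert_eq_of_mulExp_eq hW (hW' x hx).1 (hW' x hx).2

/-- **The branch point: `W(−1/e) = −1`** («the point (−1/e, −1) where the W function has a first
derivative singularity», §12 p.718 L299). [cite: Moschandreou2024b, §12 p.718 (L299)] -/
theorem lambert_apply_branchPoint {W : ℝ → ℝ} (hW : IsPrincipalLambert W) :
    W (-Real.exp (-1)) = -1 :=
  lambert_eq_of_mulExp_eq hW le_rfl mulExp_neg_one

/-- `W x ≥ −1` on the domain. [folklore] -/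
theorem lambert_neg_one_le {W : ℝ → ℝ} (hW : IsPrincipalLambert W) {x : ℝ}
    (hx : -Real.exp (-1) ≤ x) : -1 ≤ W x :=
  (hW x hx).1

/-! ### Monotonicity and continuity on `[−1/e, ∞)` -/

/-- **`W` is monotone on `[−1/e, ∞)`** (inverse of a strictly increasing map). [folklore] -/
theorem lambert_monotoneOn {W : ℝ → ℝ} (hW : IsPrincipalLambert W) :
    MonotoneOn W (Ici (-Real.exp (-1))) := by
  intro x hx x' hx' hxx'
  by_contra hlt
  push Not at hlt
  have h := strictMonoOn_mulExp (lambert_neg_one_le hW hx') (lambert_neg_one_le hW hx) hlt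
  simp only at h
  rw [mulExp_lambert hW hx', mulExp_lambert hW hx] at h
  exact absurd hxx' (not_le.2 h)

/-- **`W` is continuous on `[−1/e, ∞)`** (monotone with no jumps: every value in `[−1, ∞)` is
attained). [folklore] -/
theorem lambert_continuousOn {W : ℝ → ℝ} (hW : IsPrincipalLambert W) :
    ContinuousOn W (Ici (-Real.exp (-1))) := by
  intro a ha
  have hmono := lambert_monotoneOn hW
  -- values strictly above `W a` are attained inside the domain
  have hright : ∀ b > W a, ∃ c ∈ Ici (-Real.exp (-1)), W c ∈ Ioo (W a) b := by
    intro b hb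
    set y : ℝ := (W a + b) / 2 with hy
    have hy1 : -1 ≤ y := by have := lambert_neg_one_le hW ha; rw [hy]; linarith
    refine ⟨y * Real.exp y, neg_exp_neg_one_le_mulExp hy1, ?_⟩
    rw [lambert_apply_mulExp hW hy1]
    exact ⟨by rw [hy]; linarith, by rw [hy]; linarith⟩
  rcases eq_or_lt_of_le (mem_Ici.1 ha) with hEq | hlt
  · -- the endpoint `a = -1/e`: within `Ici a` continuity from the right suffices
    subst hEq
    exact continuousWithinAt_right_of_monotoneOn_of_exists_between hmono self_mem_nhdsWithin hright
  · -- interior point: two-sided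
    have hs : Ici (-Real.exp (-1)) ∈ 𝓝 a := Ici_mem_nhds hlt
    have hleft : ∀ b < W a, ∃ c ∈ Ici (-Real.exp (-1)), W c ∈ Ioo b (W a) := by
      intro b hb
      -- `W a > -1` since `a > -1/e` and `W` is injective-monotone
      have hWa : -1 < W a := by
        have h1 : -1 ≤ W a := lambert_neg_one_le hW ha
        rcases eq_or_lt_of_le h1 with h | h
        · exfalso
          have : W a * Real.exp (W a) = a := mulExp_lambert hW ha
          rw [← h, mulExp_neg_one] at this
          linarith
        · exact h
      set y : ℝ := (max b (-1) + W a) / 2 with hy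
      have hmax : max b (-1) < W a := max_lt hb hWa
      have hy1 : -1 ≤ y := by have := le_max_right b (-1); rw [hy]; linarith
      refine ⟨y * Real.exp y, neg_exp_neg_one_le_mulExp hy1, ?_⟩
      rw [lambert_apply_mulExp hW hy1]
      have := le_max_left b (-1)
      exact ⟨by rw [hy]; linarith, by rw [hy]; linarith⟩
    exact (continuousAt_of_monotoneOn_of_exists_between hmono hs hleft hright).continuousWithinAt

/-! ### The first-derivative singularity at the branch point -/

/-- **`W` is not differentiable (within `[−1/e, ∞)`) at `−1/e`**: differentiating
`W(x) e^{W(x)} = x` there would give `1 = (1 + W(−1/e)) e^{W(−1/e)} · W' = 0`.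
[cite: Moschandreou2024b, §12 p.718 (L299); §14 p.731 (L425)] -/
theorem lambert_not_differentiableWithinAt_branchPoint {W : ℝ → ℝ}
    (hW : IsPrincipalLambert W) :
    ¬ DifferentiableWithinAt ℝ W (Ici (-Real.exp (-1))) (-Real.exp (-1)) := by
  intro hd
  set a : ℝ := -Real.exp (-1) with ha
  have hWd : HasDerivWithinAt W (derivWithin W (Ici a) a) (Ici a) a := hd.hasDerivWithinAt
  -- chain rule for `mulExp ∘ W` within `Ici a` at `a`
  have hg : HasDerivAt (fun y : ℝ => y * Real.exp y) ((1 + W a) * Real.exp (W a)) (W a) :=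
    hasDerivAt_mulExp (W a)
  have hcomp : HasDerivWithinAt (fun x => W x * Real.exp (W x))
      (((1 + W a) * Real.exp (W a)) * derivWithin W (Ici a) a) (Ici a) a :=
    hg.comp_hasDerivWithinAt a hWd
  have hzero : ((1 + W a) * Real.exp (W a)) * derivWithin W (Ici a) a = 0 := by
    rw [ha, lambert_apply_branchPoint hW]; ring
  rw [hzero] at hcomp
  -- but `mulExp ∘ W = id` on `Ici a`, whose derivative within `Ici a` at `a` is `1`
  have hid : HasDerivWithinAt (fun x => W x * Real.exp (W x)) 1 (Ici a) a := by
    refine (hasDerivWithinAt_id a (Ici a)).congr (fun x hx => ?_) ?_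
    · exact mulExp_lambert hW hx
    · exact mulExp_lambert hW (le_refl a)
  have huniq : UniqueDiffWithinAt ℝ (Ici a) a := uniqueDiffOn_Ici a a self_mem_Ici
  have := huniq.eq_deriv _ hid hcomp
  exact one_ne_zero this

/-- **Step 3 of the skeleton HOLDS** (§12 p.718 L299: the principal real branch is continuous on
`[−1/e, ∞)`, takes the value `−1` at `−1/e`, and has a first-derivative singularity there).
[cite: Moschandreou2024b, §12 p.718 (L299); §14 p.731 (L425)] -/
theorem step_3_holds : Literature.Claims.NS.Moschandreou2024.Step_3 := fun _ hW =>
  ⟨lambert_continuousOn hW, lambert_apply_branchPoint hW, lambert_not_differentiableWithinAt_branchPoint hW⟩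

/-! ### The refuter's door to Step 6 (not a kill: the kill is the refuter's lane) -/

/-- With `W(−1/e) = −1 < −1/e`, at `t = 2` the inner argument after ONE application of `W` has left
the real domain: the 2-fold model iterate `W(W(−e^{1−t})) + 1` of Fig. 18 is not real-defined at
`t = 2`. [cite: Moschandreou2024b, §13 Figs. 17–18 pp.728 (L402–404); §12 p.718 (L299)] -/
theorem not_iterDefined_two_two {W : ℝ → ℝ} (hW : IsPrincipalLambert W) :
    ¬ Literature.Claims.NS.Moschandreou2024.IterDefined W 2 2 := by
  intro h
  have h1 := h 1 (by norm_num)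
  rw [iterArg_succ, iterArg_zero] at h1
  norm_num at h1
  rw [lambert_apply_branchPoint hW] at h1
  have : Real.exp (-1) < 1 := Real.exp_lt_one_iff.mpr (by norm_num)
  linarith

/-! ### Step 5 (shift of the blow-up times) HOLDS on the model — appended 2026-08-27 -/

/-- `W x < x` strictly on `[−1/e, 0)`: with `y = W x ∈ [−1, 0)`, `x − y = y(e^y − 1) > 0`. [folklore] -/
theorem lambert_lt_self {W : ℝ → ℝ} (hW : IsPrincipalLambert W) {x : ℝ}
    (hx : -Real.exp (-1) ≤ x) (hx0 : x < 0) : W x < x := by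
  have hWx := mulExp_lambert hW hx
  have hy1 := lambert_neg_one_le hW hx
  -- `W x < 0` (else `x = W x e^{W x} ≥ 0`)
  have hyneg : W x < 0 := by
    by_contra h
    push Not at h
    have : 0 ≤ W x * Real.exp (W x) := mul_nonneg h (Real.exp_pos _).le
    linarith
  have hexp : Real.exp (W x) < 1 := Real.exp_lt_one_iff.mpr hyneg
  -- `x - W x = W x * (exp (W x) - 1) > 0`
  nlinarith

/-- The fixed points of a principal branch on its domain: `W x = x` with `x ≥ −1/e` forces `x = 0`.
[folklore] -/
theorem lambert_eq_self_iff {W : ℝ → ℝ} (hW : IsPrincipalLambert W) {x : ℝ}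
    (hx : -Real.exp (-1) ≤ x) (hfix : W x = x) : x = 0 := by
  have hWx := mulExp_lambert hW hx
  rw [hfix] at hWx
  -- `x e^x = x` ⇒ `x (e^x - 1) = 0`
  have h : x * (Real.exp x - 1) = 0 := by linarith
  rcases mul_eq_zero.mp h with h0 | h1
  · exact h0
  · have : Real.exp x = 1 := by linarith
    simpa using Real.exp_eq_one_iff x |>.mp this

/-- Inner arguments are monotone in `t` as long as they stay in the real domain:
for `t ≤ t'` and `k < N` with `IterDefined W N t`, `−1/e ≤ W^{∘k}(−e^{1−t}) ≤ W^{∘k}(−e^{1−t'})`.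
[cite: Moschandreou2024b, §13 Figs. 17–22 pp.728–729 (L402–412)] -/
theorem iterArg_mono {W : ℝ → ℝ} (hW : IsPrincipalLambert W) {N : ℕ} {t t' : ℝ} (htt' : t ≤ t')
    (hdef : IterDefined W N t) :
    ∀ k, k < N → -Real.exp (-1) ≤ iterArg W k t ∧ iterArg W k t ≤ iterArg W k t' := by
  intro k
  induction k with
  | zero =>
    intro hk
    refine ⟨hdef 0 hk, ?_⟩
    rw [iterArg_zero, iterArg_zero]
    have : Real.exp (1 - t') ≤ Real.exp (1 - t) := Real.exp_le_exp.mpr (by linarith)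
    linarith
  | succ k ih =>
    intro hk
    have hk' : k < N := lt_of_le_of_lt (Nat.le_succ k) hk
    obtain ⟨hdk, hle⟩ := ih hk'
    refine ⟨hdef (k + 1) hk, ?_⟩
    rw [iterArg_succ, iterArg_succ]
    exact lambert_monotoneOn hW hdk (le_trans hdk hle) hle

/-- **Step 5 (ii)**: real-definedness of the `N`-fold iterate is monotone in `t` (the blow-up time is a
threshold). [cite: Moschandreou2024b, §13 p.727 (L395); §16 p.737 (L474–475)] -/
theorem iterDefined_mono {W : ℝ → ℝ} (hW : IsPrincipalLambert W) (N : ℕ) {t t' : ℝ} (htt' : t ≤ t')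
    (hdef : IterDefined W N t) : IterDefined W N t' := fun k hk =>
  let h := iterArg_mono hW htt' hdef k hk
  le_trans h.1 h.2

/-- **Step 5 (iii)**: at every time `T` some iterate has left the real domain — the `N`-th blow-up time
exceeds `T` for `N` large. (If all inner arguments stayed `≥ −1/e`, the sequence
`a_k = W^{∘k}(−e^{1−T})` would be strictly decreasing (`W x < x` on `[−1/e,0)`), bounded below, hence
convergent to some `L ∈ [−1/e, a₀]`, `a₀ < 0`; continuity of `W` gives `W L = L`, so `L = 0` — absurd.)
[cite: Moschandreou2024b, §13 p.727 (L395); §16 p.737 (L474–475); App. 2 Fig. A1 p.742] -/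
theorem exists_not_iterDefined {W : ℝ → ℝ} (hW : IsPrincipalLambert W) (T : ℝ) :
    ∃ N : ℕ, ¬ IterDefined W N T := by
  by_contra hall
  push Not at hall
  -- all inner arguments are in the domain
  have hdom : ∀ k, -Real.exp (-1) ≤ iterArg W k T := fun k => hall (k + 1) k (Nat.lt_succ_self k)
  set a : ℕ → ℝ := fun k => iterArg W k T with ha
  have ha0 : a 0 < 0 := by
    show iterArg W 0 T < 0
    rw [iterArg_zero]
    have := Real.exp_pos (1 - T)
    linarith
  -- negative and strictly decreasing
  have hneg : ∀ k, a k < 0 := by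
    intro k
    induction k with
    | zero => exact ha0
    | succ k ih =>
      show iterArg W (k + 1) T < 0
      rw [iterArg_succ]
      exact lt_trans (lambert_lt_self hW (hdom k) ih) ih
  have hanti : Antitone a := by
    refine antitone_nat_of_succ_le fun k => ?_
    show iterArg W (k + 1) T ≤ iterArg W k T
    rw [iterArg_succ]
    exact (lambert_lt_self hW (hdom k) (hneg k)).le
  have hbdd : BddBelow (range a) := ⟨-Real.exp (-1), by rintro _ ⟨k, rfl⟩; exact hdom k⟩
  -- the limit
  have hlim : Tendsto a atTop (𝓝 (⨅ k, a k)) := tendsto_atTop_ciInf hanti hbdd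
  set L := ⨅ k, a k with hL
  have hLdom : -Real.exp (-1) ≤ L := le_ciInf fun k => hdom k
  have hLle : L ≤ a 0 := ciInf_le hbdd 0
  -- `W ∘ a → W L` by continuity within the domain, and `W ∘ a = a ∘ succ → L`
  have hcont : ContinuousWithinAt W (Ici (-Real.exp (-1))) L := lambert_continuousOn hW L hLdom
  have hwithin : Tendsto a atTop (𝓝[Ici (-Real.exp (-1))] L) :=
    tendsto_nhdsWithin_iff.2 ⟨hlim, Eventually.of_forall fun k => hdom k⟩
  have h1 : Tendsto (fun k => W (a k)) atTop (𝓝 (W L)) := hcont.tendsto.comp hwithin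
  have h2 : Tendsto (fun k => W (a k)) atTop (𝓝 L) := by
    have : (fun k => W (a k)) = fun k => a (k + 1) := by
      funext k
      show W (iterArg W k T) = iterArg W (k + 1) T
      rw [iterArg_succ]
    rw [this]
    exact hlim.comp (tendsto_add_atTop_nat 1)
  have hfix : W L = L := tendsto_nhds_unique h1 h2
  have hL0 : L = 0 := lambert_eq_self_iff hW hLdom hfix
  linarith

/-- **Step 5 of the skeleton HOLDS** (§13 p.727 L395, §16 p.737 L474–475: «compositions of n W functions
results in a shift towards t → +∞», «applying W(W(W⋯W(v_i))) n-times keeps moving the blowup points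
further and further to the right») — on the real branch the model iterates behave exactly as printed.
Together with `exists_isPrincipalLambert` and the skeleton's `not_step_6_of_step_5`, Step 6 («in the
limit, a constant for all t») is therefore FALSE on the reals — the typist's internal-inconsistency
record made unconditional. [cite: Moschandreou2024b, §13 p.727 (L395); §16 p.737 (L474–475)] -/
theorem step_5_holds : Literature.Claims.NS.Moschandreou2024.Step_5 := fun _ hW =>
  ⟨fun N _ _ htt' hdef => iterDefined_mono hW N htt' hdef, fun T => exists_not_iterDefined hW T⟩

/-- **Step 6 is false on the reals** — now unconditional (the skeleton's `not_step_6_of_step_5` with its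
two hypotheses discharged by `exists_isPrincipalLambert` and `step_5_holds`). Recorded here as the
salvage-side consequence; the refuter's lane keys the verdict. [cite: Moschandreou2024b, §13 p.727 (L397); §16 p.737 (L477–479)] -/
theorem not_step_6 : ¬ Literature.Claims.NS.Moschandreou2024.Step_6 :=
  not_step_6_of_step_5 exists_isPrincipalLambert step_5_holds

end Summit.NavierStokesRegularity.NavierStokesRegularity.Theorems.Moschandreou2024

end
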